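import Summits.QuantumAdvantage.QuantumAdvantage.Theorems.StickelbergerGridGaussPowerIntegral

/-!
# QuantumAdvantage / StickelbergerGrid — `GaussPowerNotReal` (stmt-QuantumAdvantage-17352), part 1: Frobenius

Part 1 of 2 (this file: divisibility by `p` in a subring `𝒪 ⊆ ℂ`, freshman's dream, the
Frobenius congruence `g(φ,ψ')^p ∈ p𝒪` and `g(φ,ψ') ∈ ℤ[ζ] ⇒ g(φ,ψ') ∈ p𝒪`; part 2,
`StickelbergerGridGaussPowerNotReal.lean`, has the theorem). The CUT LEMMA (qualitative part) of
route StickelbergerGrid, PROVED: for valid `(p, ℓ, r)` the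
`ℓ`-th power `S^ℓ` of the order-`ℓ` Gauss sum `S` (see `StickelbergerGridGaussPowerIntegral.lean`,
where `S = g(χ, ψ)` is identified) is NOT real.

Proof (an integrality argument; no Galois theory is needed). Let `ζ = e^{2πi/ℓ}`, `ξ = e^{2πi/p}`,
`𝒪 = ℤ[ζ, ξ]` (a ring of algebraic integers) and `ψ` the standard additive character of `ℤ/p`.
* If `S^ℓ` were real then, with `S̄ = g(χ̄, ψ̄)` and `S S̄ = p`, `(S^ℓ)² = (S S̄)^ℓ = p^ℓ`, so
  `S² = ζ^k p` for some `k`; since `S² = J(χ,χ) g(χ², ψ)` and `J(χ,χ) J(χ̄,χ̄) = p`, we get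
  `G := g(χ², ψ) = ζ^k J(χ̄, χ̄) ∈ ℤ[ζ]` and likewise `H := g(χ̄², ψ̄) = ζ^{ℓ−k} J(χ,χ) ∈ ℤ[ζ]`,
  with `G H = p`.
* FROBENIUS: for any nontrivial `φ` with `φ^ℓ = 1` and `ψ' ∈ {ψ, ψ̄}`,
  `g(φ, ψ')^p ≡ Σ_x φ(x)^p ψ'(x)^p = Σ_x φ(x) = 0 (mod p𝒪)` (`p ≡ 1 (mod ℓ)`, `ψ'(x)^p = 1`);
  and if `g(φ,ψ') = Σ c_j ζ^j ∈ ℤ[ζ]` then also `g(φ,ψ')^p ≡ Σ c_j^p ζ^{jp} ≡ g(φ, ψ') (mod p𝒪)`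
  (Fermat), so `g(φ, ψ') ∈ p𝒪`.
* Hence `G = p w`, `H = p w'` with `w, w' ∈ 𝒪`, and `p = G H = p² w w'` gives `1/p = w w' ∈ 𝒪`,
  an algebraic integer — impossible (`ℤ` is integrally closed).

HONEST FRAMING (block-2b rule): the value here is a closed ledger item (a classical lemma,
kernel-checked), not summit progress.

References: K. Ireland, M. Rosen, *A Classical Introduction to Modern Number Theory*, GTM 84
(1990), Ch. 8 §§2–3 (Gauss and Jacobi sums), Ch. 6 §3 (algebraic integers), Ch. 14 §3
(Stickelberger congruence — the divisibility `g(χ)^p ≡ 0` is its crudest case)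
[IrelandRosen1990]; L. C. Washington, *Introduction to Cyclotomic Fields*, GTM 83 (1997),
§6.1 [Washington1997].
-/

set_option linter.dupNamespace false -- D-0017: single-problem summit ⇒ `QuantumAdvantage.QuantumAdvantage` by design

namespace Summit.QuantumAdvantage.QuantumAdvantage.Theorems.GaussPowerNotReal

open Finset Summit.QuantumAdvantage.QuantumAdvantage.Theorems.GaussPowerIntegral

/-! ### Divisibility by `p` inside a subring `𝒪 ⊆ ℂ` -/

section PDvd

variable {O : Subalgebra ℤ ℂ} {p : ℕ}

/-- `p𝒪` is closed under addition. [folklore] -/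
theorem pdvd_add {a b : ℂ} (ha : ∃ w ∈ O, a = p * w) (hb : ∃ w ∈ O, b = p * w) :
    ∃ w ∈ O, a + b = p * w := by
  obtain ⟨u, hu, rfl⟩ := ha
  obtain ⟨v, hv, rfl⟩ := hb
  exact ⟨u + v, add_mem hu hv, by ring⟩

/-- `p𝒪` is closed under subtraction. [folklore] -/
theorem pdvd_sub {a b : ℂ} (ha : ∃ w ∈ O, a = p * w) (hb : ∃ w ∈ O, b = p * w) :
    ∃ w ∈ O, a - b = p * w := by
  obtain ⟨u, hu, rfl⟩ := ha
  obtain ⟨v, hv, rfl⟩ := hb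
  exact ⟨u - v, sub_mem hu hv, by ring⟩

/-- `p𝒪` is closed under finite sums. [folklore] -/
theorem pdvd_sum {ι : Type*} (s : Finset ι) (f : ι → ℂ) (hf : ∀ i ∈ s, ∃ w ∈ O, f i = p * w) :
    ∃ w ∈ O, ∑ i ∈ s, f i = p * w := by
  classical
  induction s using Finset.induction_on with
  | empty => exact ⟨0, zero_mem _, by simp⟩
  | insert a s has ih =>
    rw [Finset.sum_insert has]
    exact pdvd_add (hf a (Finset.mem_insert_self a s))
      (ih fun i hi => hf i (Finset.mem_insert_of_mem hi))

/-- FRESHMAN'S DREAM modulo `p𝒪`: `(a + b)^p − a^p − b^p ∈ p𝒪` for `a, b ∈ 𝒪`, `p` prime.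
[folklore] -/
theorem frob_add (hp : p.Prime) {a b : ℂ} (ha : a ∈ O) (hb : b ∈ O) :
    ∃ w ∈ O, (a + b) ^ p - a ^ p - b ^ p = p * w := by
  refine ⟨∑ k ∈ Finset.Ioo 0 p, a ^ k * b ^ (p - k) * ((p.choose k / p : ℕ) : ℂ), ?_, ?_⟩
  · refine sum_mem fun k _ => mul_mem (mul_mem (pow_mem ha _) (pow_mem hb _)) ?_
    exact Subalgebra.natCast_mem O _
  · rw [add_pow_prime_eq' hp a b]
    ring

/-- FRESHMAN'S DREAM for finite sums: `(Σ f i)^p − Σ (f i)^p ∈ p𝒪` when all `f i ∈ 𝒪`.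
[folklore] -/
theorem frob_sum (hp : p.Prime) {ι : Type*} (s : Finset ι) (f : ι → ℂ) (hf : ∀ i ∈ s, f i ∈ O) :
    ∃ w ∈ O, (∑ i ∈ s, f i) ^ p - ∑ i ∈ s, f i ^ p = p * w := by
  classical
  induction s using Finset.induction_on with
  | empty => exact ⟨0, zero_mem _, by simp [hp.ne_zero]⟩
  | insert a s has ih =>
    rw [Finset.sum_insert has, Finset.sum_insert has]
    have hT : ∑ i ∈ s, f i ∈ O := sum_mem fun i hi => hf i (Finset.mem_insert_of_mem hi)
    have h1 := frob_add hp (hf a (Finset.mem_insert_self a s)) hT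
    have h2 := ih fun i hi => hf i (Finset.mem_insert_of_mem hi)
    obtain ⟨w, hw, e⟩ := pdvd_add h1 h2
    exact ⟨w, hw, by linear_combination e⟩

/-- `1/p ∉ 𝒪` when `𝒪` consists of algebraic integers (`ℤ` is integrally closed) and `p > 1`.
[folklore] -/
theorem inv_not_mem (hp : p.Prime) (hO : O ≤ integralClosure ℤ ℂ) : ((p : ℂ))⁻¹ ∉ O := by
  intro h
  have hint : IsIntegral ℤ ((p : ℂ))⁻¹ := (mem_integralClosure_iff ℤ ℂ).1 (hO h)
  have hq : ((p : ℂ))⁻¹ = algebraMap ℚ ℂ ((p : ℚ))⁻¹ := by simp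
  rw [hq, isIntegral_algebraMap_iff (algebraMap ℚ ℂ).injective,
    IsIntegrallyClosed.isIntegral_iff] at hint
  obtain ⟨y, hy⟩ := hint
  have hy' : (y : ℚ) * p = 1 := by
    rw [show (algebraMap ℤ ℚ) y = (y : ℚ) from rfl] at hy
    rw [hy, inv_mul_cancel₀]
    exact_mod_cast hp.ne_zero
  have hyp : y * (p : ℤ) = 1 := by exact_mod_cast hy'
  have h2 := hp.two_le
  rcases Int.eq_one_or_neg_one_of_mul_eq_one' hyp with ⟨_, h⟩ | ⟨_, h⟩ <;> omega

end PDvd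

/-! ### The ring `𝒪 = ℤ[ζ, ξ]` and the Frobenius congruence for Gauss sums -/

section Frobenius

variable {p : ℕ} [hp : Fact p.Prime]

/-- The standard additive character takes values `ξ^{x.val}`, `ξ = e^{2πi/p}`. [folklore] -/
theorem stdAddChar_eq_pow (x : ZMod p) :
    ZMod.stdAddChar x = Complex.exp (2 * Real.pi * Complex.I / p) ^ x.val := by
  rw [← ZMod.natCast_zmod_val x, stdAddChar_natCast, ZMod.natCast_zmod_val, ← Complex.exp_nat_mul]
  congr 1
  ring

/-- FROBENIUS FOR GAUSS SUMS. Let `𝒪 ⊆ ℂ` be a subring, `φ ≠ 1` a multiplicative character of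
`𝔽_p` with `φ^ℓ = 1`, `ℓ ∣ p − 1`, all `φ(x) ∈ 𝒪`, and `ψ'` an additive character of `𝔽_p` with
values in `𝒪`. Then `g(φ, ψ')^p ∈ p𝒪` (`g^p ≡ Σ φ(x)^p ψ'(x)^p = Σ φ(x) = 0`).
[Ireland–Rosen 1990, Ch. 14 §3 (crudest case of Stickelberger)] [folklore] -/
theorem gaussSum_pow_mem {O : Subalgebra ℤ ℂ} {ℓ : ℕ} (hℓp : p % ℓ = 1) {φ : MulChar (ZMod p) ℂ}
    (hφ1 : φ ≠ 1) (hφℓ : φ ^ ℓ = 1) (hφO : ∀ x, φ x ∈ O) {ψ' : AddChar (ZMod p) ℂ}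
    (hψO : ∀ x, ψ' x ∈ O) : ∃ w ∈ O, gaussSum φ ψ' ^ p = p * w := by
  have hterm : ∀ x : ZMod p, (φ x * ψ' x) ^ p = φ x := by
    intro x
    rw [mul_pow, ← AddChar.map_nsmul_eq_pow, nsmul_eq_mul, ZMod.natCast_self, zero_mul,
      AddChar.map_zero_eq_one, mul_one]
    rcases eq_or_ne x 0 with rfl | hx
    · rw [MulChar.map_zero, zero_pow hp.out.ne_zero]
    · have hℓ0 : ℓ ≠ 0 := by
        rintro rfl
        rw [Nat.mod_zero] at hℓp
        exact hp.out.one_lt.ne' hℓp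
      have hℓ1 : φ x ^ ℓ = 1 := by
        rw [← MulChar.pow_apply' φ hℓ0 x, hφℓ, MulChar.one_apply (IsUnit.mk0 x hx)]
      rw [pow_eq_pow_mod hℓ1, hℓp, pow_one]
  have h1 := frob_sum hp.out (Finset.univ : Finset (ZMod p)) (fun x => φ x * ψ' x)
    (fun x _ => mul_mem (hφO x) (hψO x))
  simp_rw [hterm, MulChar.sum_eq_zero_of_ne_one hφ1, sub_zero] at h1
  exact h1

/-- … and if moreover `g(φ, ψ') ∈ ℤ[ζ]` (`ζ` a primitive `ℓ`-th root of unity in `𝒪`, `ℓ` prime,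
`p ≡ 1 (mod ℓ)`), then `g(φ, ψ')^p ≡ g(φ, ψ') (mod p𝒪)` (Fermat on the integer coefficients and
`ζ^{jp} = ζ^j`), hence `g(φ, ψ') ∈ p𝒪`. [folklore] -/
theorem gaussSum_mem_of_mem_adjoin {O : Subalgebra ℤ ℂ} {ℓ : ℕ} (hℓ : ℓ.Prime) (hℓp : p % ℓ = 1)
    {ζ : ℂ} (hζ : IsPrimitiveRoot ζ ℓ) (hζO : ζ ∈ O) {φ : MulChar (ZMod p) ℂ} (hφ1 : φ ≠ 1)
    (hφℓ : φ ^ ℓ = 1) (hφO : ∀ x, φ x ∈ O) {ψ' : AddChar (ZMod p) ℂ} (hψO : ∀ x, ψ' x ∈ O)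
    (hmem : gaussSum φ ψ' ∈ Algebra.adjoin ℤ ({ζ} : Set ℂ)) :
    ∃ w ∈ O, gaussSum φ ψ' = p * w := by
  obtain ⟨c, hc⟩ := nf_of_mem_adjoin hℓ hζ hmem
  have hζℓ : ζ ^ ℓ = 1 := hζ.pow_eq_one
  -- `G^p − Σ (c_j ζ^j)^p ∈ p𝒪`
  have h1 := frob_sum hp.out (Finset.univ : Finset (Fin (ℓ - 1)))
    (fun j => ((c j : ℤ) : ℂ) * ζ ^ (j.val)) (fun j _ => mul_mem (Subalgebra.intCast_mem O _)
      (pow_mem hζO _))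
  rw [← hc] at h1
  -- `(c_j ζ^j)^p − c_j ζ^j ∈ p𝒪`
  have h2 : ∃ w ∈ O, (∑ j : Fin (ℓ - 1), (((c j : ℤ) : ℂ) * ζ ^ (j.val)) ^ p) -
      ∑ j : Fin (ℓ - 1), ((c j : ℤ) : ℂ) * ζ ^ (j.val) = p * w := by
    rw [← Finset.sum_sub_distrib]
    refine pdvd_sum _ _ fun j _ => ?_
    have hzp : (ζ ^ (j.val)) ^ p = ζ ^ (j.val) := by
      rw [← pow_mul, pow_eq_pow_mod hζℓ, Nat.mul_mod, hℓp, mul_one, Nat.mod_mod,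
        ← pow_eq_pow_mod hζℓ]
    obtain ⟨d, hd⟩ : (p : ℤ) ∣ (c j) ^ p - c j := by
      rw [← ZMod.intCast_zmod_eq_zero_iff_dvd]
      push_cast
      rw [ZMod.pow_card, sub_self]
    refine ⟨(d : ℂ) * ζ ^ (j.val), mul_mem (Subalgebra.intCast_mem O _) (pow_mem hζO _), ?_⟩
    rw [mul_pow, hzp, ← sub_mul, ← Int.cast_pow, ← Int.cast_sub, hd]
    push_cast
    ring
  rw [← hc] at h2
  -- combine with `G^p ∈ p𝒪`
  have h3 := gaussSum_pow_mem hℓp hφ1 hφℓ hφO hψO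
  obtain ⟨w, hw, e⟩ := pdvd_sub (pdvd_sub h3 h1) h2
  exact ⟨w, hw, by linear_combination e⟩

end Frobenius

end Summit.QuantumAdvantage.QuantumAdvantage.Theorems.GaussPowerNotReal
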